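import Mathlib
import Summits.ValiantsHypothesis.ValiantsHypothesis.Theorems.FeketeSOSCharPSparseSOSQRPerfectBarrier

/-!
# Crux `FeketeSOS.CharPSparseSOS` (stmt-ValiantsHypothesis-14989), line `Sketch` — the approximate
Shkredov barrier: restricted pair sums of a small set are far from the quadratic residues

For a prime `p` and `Q ⊆ [0, p)` let `r_Q(n) = #{a < b in Q : a + b ≡ n (mod p)}` be the restricted
pair-sum count and `1_QR(n) = [n ≠ 0, (n|p) = 1]` the indicator of the non-zero quadratic residues; let
`e = #{n < p : r_Q(n) ≠ 1_QR(n)}` be the number of residues where they disagree.  In `(ZMod p)[X]` the fold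
identity `Cq² ≡ Dq + 2 ∑_n r_Q(n) X^n (mod X^p − 1)` (`Cq = ∑_{a∈Q} X^a`, `Dq = ∑_{a∈Q} X^{2a mod p}`, no
hypothesis on `Q`), the Fekete pattern `F̄_p = 2 ∑_n 1_QR(n) X^n − (X + ⋯ + X^{p−1})`, the digit tiling of the
all-ones polynomial, and the ERROR POLYNOMIAL `Er = ∑_n (r_Q(n) − 1_QR(n)) X^n` (at most `e` monomials) give
a NINE-square cyclic representation
`F̄_p ≡ Cq² − ¼(1+Dq)² + ¼(1−Dq)² − ¼(P+Q)² + ¼(P−Q)² − ¼(M+T)² + ¼(M−T)² − ½(1+Er)² + ½(1−Er)²`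
of degree `< p` and support-sum `≤ 3|Q| + 2e + 6√p + 10`.  Hence the crux `CharPSparseSOS` forces
`3|Q| + 2e + 13√p + 13 ≥ p^{1/2+δ}` for all large primes: `rQ_far_from_QR_of_charPSparseSOS`.  This is the
kernel-checked approximate form of the Paley/Shkredov sum-set barrier (the `e = 0` case is
`no_qrPerfectSumSet_of_charPSparseSOS`): a proof of the crux must in particular show that `1_QR` is
`p^{1/2+δ}`-far from every restricted pair-sum function `r_Q` with `|Q| ≤ p^{1/2+δ}`.
-/

-- `Summit.ValiantsHypothesis.ValiantsHypothesis.…` is the tree's mandated single-conjunct layout (Sub = Summit).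
set_option linter.dupNamespace false

namespace Summit.ValiantsHypothesis.ValiantsHypothesis.Theorems.CharPSparseSOSTwoCusp

open Polynomial Finset
open Summit.ValiantsHypothesis.ValiantsHypothesis.Theorems.CharPSparseSOS.Negative
  (lowDigits highDigits card_support_add_le card_support_sub_le card_support_sum_le
    card_support_sum_X_pow_le card_support_X_pow_le card_support_lowDigits card_support_highDigits
    natDegree_lowDigits natDegree_highDigits ones_digit_identity four_ne_zero_zmod)

noncomputable section

variable {K : Type} [Field K]

/-! ## The fold identity and the Fekete pattern, with abstract coefficient functions -/

/-- **Fold identity** (no hypothesis on `Q`), single-filter form: modulo `X^p − 1`,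
`(∑_{a∈Q} X^a)² ≡ ∑_{a∈Q} X^{2a mod p} + 2 ∑_{n<p} #{(a,b) ∈ Q × Q : a < b, a + b ≡ n} X^n`. -/
theorem rqf_fold_identity (p : ℕ) (hp : 0 < p) (Q : Finset ℕ) :
    (X : K[X]) ^ p - 1 ∣ (∑ a ∈ Q, (X : K[X]) ^ a) ^ 2 -
      (∑ a ∈ Q, (X : K[X]) ^ ((2 * a) % p) +
        2 * ∑ n ∈ range p, (((Q ×ˢ Q).filter
          (fun ab : ℕ × ℕ => ab.1 < ab.2 ∧ (ab.1 + ab.2) % p = n)).card : K[X]) * X ^ n) := by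
  simpa only [filter_filter] using qrp_fold_identity (K := K) p hp Q

/-- **The reduced Fekete polynomial is `2 R − (X + ⋯ + X^{p−1})`**, with `R = ∑_{n<p} v(n) X^n` for any
function `v` that is the indicator of the non-zero quadratic residues on `[0, p)`. -/
theorem rqf_fekete_eq (p : ℕ) [Fact p.Prime] (v : ℕ → ℕ)
    (hv : ∀ n, v n = if n ≠ 0 ∧ legendreSym p n = 1 then 1 else 0) :
    (∑ m ∈ range p, C ((legendreSym p m : ℤ) : K) * X ^ m) =
      2 * (∑ n ∈ range p, (v n : K[X]) * X ^ n) - ∑ m ∈ range (p - 1), (X : K[X]) ^ (m + 1) := by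
  rw [qrp_fekete_eq]
  congr 2
  refine sum_congr rfl fun n _ => ?_
  rw [hv n]
  split_ifs <;> simp

/-! ## The error polynomial -/

/-- The difference of two natural-coefficient polynomials on the same exponent set is the polynomial of
coefficient differences: `∑ u(n) X^n − ∑ v(n) X^n = ∑ (u(n) − v(n)) X^n`. -/
theorem rqf_err_poly_eq (s : Finset ℕ) (u v : ℕ → ℕ) :
    (∑ n ∈ s, (u n : K[X]) * X ^ n) - (∑ n ∈ s, (v n : K[X]) * X ^ n) =
      ∑ n ∈ s, C ((u n : K) - (v n : K)) * X ^ n := by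
  rw [← sum_sub_distrib]
  refine sum_congr rfl fun n _ => ?_
  rw [map_sub, map_natCast, map_natCast, sub_mul]

/-- A polynomial `∑_{n∈s} w(n) X^n` has at most `#{n ∈ s : w(n) ≠ 0}` monomials. -/
theorem rqf_card_support_sum_C_mul_X_pow_le [DecidableEq K] (s : Finset ℕ) (w : ℕ → K) :
    (∑ n ∈ s, C (w n) * X ^ n).support.card ≤ (s.filter (fun n => w n ≠ 0)).card := by
  have h : ∑ n ∈ s.filter (fun n => w n ≠ 0), C (w n) * X ^ n = ∑ n ∈ s, C (w n) * X ^ n :=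
    sum_filter_of_ne fun n _ hn => fun h0 => hn (by rw [h0, C_0, zero_mul])
  have h1 : ∀ n ∈ s.filter (fun n => w n ≠ 0),
      (fun m => (C (w m) * X ^ m).support.card) n ≤ (fun _ => 1) n :=
    fun n _ => card_support_C_mul_X_pow_le_one
  have h2 := sum_le_sum h1
  simp only [sum_const, smul_eq_mul, mul_one] at h2
  rw [← h]
  exact (card_support_sum_le _ _).trans h2

/-- **Support of the error polynomial**: `∑_{n∈s} (u(n) − v(n)) X^n` has at most `#{n ∈ s : u(n) ≠ v(n)}`
monomials. -/
theorem rqf_card_support_err_le (s : Finset ℕ) (u v : ℕ → ℕ) :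
    (∑ n ∈ s, C ((u n : K) - (v n : K)) * X ^ n).support.card ≤
      (s.filter (fun n => u n ≠ v n)).card := by
  classical
  refine (rqf_card_support_sum_C_mul_X_pow_le s _).trans (card_le_card fun n hn => ?_)
  rw [mem_filter] at hn ⊢
  exact ⟨hn.1, fun h => hn.2 (by rw [h, sub_self])⟩

/-! ## The nine-square witness -/

/-- `Cq² − ¼(1+Dq)² + ¼(1−Dq)² − ¼(P+Q)² + ¼(P−Q)² − ¼(M+T)² + ¼(M−T)² − ½(1+E)² + ½(1−E)²
 = Cq² − Dq − (PQ + MT) − 2E` whenever `4 ≠ 0` in `K`. -/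
theorem rqf_nine_sum (h4 : (4 : K) ≠ 0) (Cq Dq P Q M T E : K[X]) :
    (∑ i, C ((![1, -1 / 4, 1 / 4, -1 / 4, 1 / 4, -1 / 4, 1 / 4, -1 / 2, 1 / 2] : Fin 9 → K) i) *
        (![Cq, 1 + Dq, 1 - Dq, P + Q, P - Q, M + T, M - T, 1 + E, 1 - E] : Fin 9 → K[X]) i ^ 2) =
      Cq ^ 2 - Dq - (P * Q + M * T) - 2 * E := by
  have h2 : (2 : K) ≠ 0 := fun h => h4 (by rw [show (4 : K) = 2 * 2 by norm_num, h, mul_zero])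
  have h4' : C (1 / 4 : K) * 4 = 1 := by
    rw [show (4 : K[X]) = C 4 from (map_ofNat C 4).symm, ← C_mul, ← C_1]
    congr 1; exact one_div_mul_cancel h4
  have h2' : C (1 / 2 : K) * 2 = 1 := by
    rw [show (2 : K[X]) = C 2 from (map_ofNat C 2).symm, ← C_mul, ← C_1]
    congr 1; exact one_div_mul_cancel h2
  have hneg : C (-1 / 4 : K) = -C (1 / 4 : K) := by
    rw [← map_neg]; congr 1; ring
  have hneg2 : C (-1 / 2 : K) = -C (1 / 2 : K) := by
    rw [← map_neg]; congr 1; ring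
  simp only [Fin.sum_univ_succ, Fin.sum_univ_zero, Matrix.cons_val_zero, Matrix.cons_val_succ, hneg,
    hneg2, C_1, one_mul, add_zero]
  linear_combination (-(Dq + P * Q + M * T)) * h4' + (-(2 * E)) * h2'

/-- **The nine-square witness.**  Let `Q ⊆ [0, N]`, `N + 1` prime, and let `u, v : ℕ → ℕ` be the restricted
pair-sum counts of `Q` (all that is used: the fold identity `Cq² ≡ Dq + 2 ∑ u(n) X^n (mod X^{N+1} − 1)`) and
the indicator of the non-zero quadratic residues; let `e ≥ #{n ≤ N : u(n) ≠ v(n)}` and `N = ab + r` a tiling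
(`1 ≤ r`, `a ≤ N`).  Then the weights `1, −¼, ¼, −¼, ¼, −¼, ¼, −½, ½` and the bases `Cq`, `1 ± Dq`,
`lowDigits a ± highDigits a b`, `X^{ab+1} ± (1 + ⋯ + X^{r−1})`, `1 ± Er` (`Er = ∑ (u(n) − v(n)) X^n`) form a
cyclic representation of `F̄_{N+1}` of degree `< N + 1` and support-sum `≤ 3|Q| + 2(a + b + r) + 2e + 6`. -/
theorem rqf_witness (N : ℕ) [Fact (N + 1).Prime] (h4 : (4 : K) ≠ 0) (Q : Finset ℕ)
    (hQ : ∀ x ∈ Q, x < N + 1) (u v : ℕ → ℕ)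
    (hfold : (X : K[X]) ^ (N + 1) - 1 ∣ (∑ x ∈ Q, (X : K[X]) ^ x) ^ 2 -
      (∑ x ∈ Q, (X : K[X]) ^ ((2 * x) % (N + 1)) +
        2 * ∑ n ∈ range (N + 1), (u n : K[X]) * X ^ n))
    (hv : ∀ n, v n = if n ≠ 0 ∧ legendreSym (N + 1) n = 1 then 1 else 0)
    (e : ℕ) (he : ((range (N + 1)).filter (fun n => u n ≠ v n)).card ≤ e)
    (a b r : ℕ) (hN : N = a * b + r) (hr : 1 ≤ r) (ha : a ≤ N) :
    ∃ (c : Fin 9 → K) (g : Fin 9 → K[X]), (∀ i, (g i).natDegree < N + 1) ∧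
      ((X : K[X]) ^ (N + 1) - 1 ∣ (∑ i, C (c i) * g i ^ 2) -
        ∑ m ∈ range (N + 1), C ((legendreSym (N + 1) m : ℤ) : K) * X ^ m) ∧
      (∑ i, ((g i).support.card : ℝ)) ≤ 3 * Q.card + 2 * (a + b + r) + 2 * e + 6 := by
  have hE := rqf_err_poly_eq (K := K) (range (N + 1)) u v
  have hEc' := (rqf_card_support_err_le (K := K) (range (N + 1)) u v).trans he
  set Cq : K[X] := ∑ x ∈ Q, X ^ x with hCq
  set Dq : K[X] := ∑ x ∈ Q, X ^ ((2 * x) % (N + 1)) with hDq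
  set M : K[X] := X ^ (a * b + 1) with hM
  set T : K[X] := ∑ k ∈ range r, X ^ k with hT
  set Er : K[X] := ∑ n ∈ range (N + 1), C ((u n : K) - (v n : K)) * X ^ n with hEr
  refine ⟨![1, -1 / 4, 1 / 4, -1 / 4, 1 / 4, -1 / 4, 1 / 4, -1 / 2, 1 / 2],
    ![Cq, 1 + Dq, 1 - Dq, lowDigits K a + highDigits K a b, lowDigits K a - highDigits K a b, M + T, M - T,
      1 + Er, 1 - Er], ?_, ?_, ?_⟩
  · -- degrees
    have hC : Cq.natDegree ≤ N :=
      natDegree_sum_le_of_forall_le _ _ fun x hx => (natDegree_X_pow_le _).trans (by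
        have := hQ x hx; omega)
    have hD : Dq.natDegree ≤ N :=
      natDegree_sum_le_of_forall_le _ _ fun x _ => (natDegree_X_pow_le _).trans (by
        have := Nat.mod_lt (2 * x) (show 0 < N + 1 by omega); omega)
    have hl : (lowDigits K a).natDegree ≤ N := (natDegree_lowDigits a).trans ha
    have hh : (highDigits K a b).natDegree ≤ N :=
      (natDegree_highDigits a b).trans (le_trans (Nat.mul_le_mul_left a (Nat.sub_le b 1)) (by omega))
    have hM' : M.natDegree ≤ N := (natDegree_X_pow_le _).trans (by omega)
    have hT' : T.natDegree ≤ N :=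
      natDegree_sum_le_of_forall_le _ _ fun k hk => (natDegree_X_pow_le _).trans (by
        have := mem_range.mp hk; omega)
    have hEd : Er.natDegree ≤ N :=
      natDegree_sum_le_of_forall_le _ _ fun n hn => (natDegree_C_mul_X_pow_le _ _).trans (by
        have := mem_range.mp hn; omega)
    have h1 : (1 : K[X]).natDegree ≤ N := by simp
    intro i
    refine Nat.lt_succ_of_le ?_
    fin_cases i
    · exact hC
    · exact (natDegree_add_le _ _).trans (max_le h1 hD)
    · exact (natDegree_sub_le _ _).trans (max_le h1 hD)
    · exact (natDegree_add_le _ _).trans (max_le hl hh)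
    · exact (natDegree_sub_le _ _).trans (max_le hl hh)
    · exact (natDegree_add_le _ _).trans (max_le hM' hT')
    · exact (natDegree_sub_le _ _).trans (max_le hM' hT')
    · exact (natDegree_add_le _ _).trans (max_le h1 hEd)
    · exact (natDegree_sub_le _ _).trans (max_le h1 hEd)
  · -- the cyclic identity: Cq² − Dq − Ones − 2 Er ≡ 2 Rv − Ones since Cq² − Dq ≡ 2 Ru = 2 Rv + 2 Er
    rw [rqf_nine_sum h4, hM, hT, ← ones_digit_identity a b r, ← hN, rqf_fekete_eq (N + 1) v hv,
      Nat.add_sub_cancel]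
    convert hfold using 1
    rw [← hE]
    ring
  · -- support-sum bookkeeping
    have hC : (Cq.support.card : ℝ) ≤ Q.card := by
      exact_mod_cast card_support_sum_X_pow_le Q (fun x => x)
    have hD : (Dq.support.card : ℝ) ≤ Q.card := by
      exact_mod_cast card_support_sum_X_pow_le Q (fun x => (2 * x) % (N + 1))
    have hl : ((lowDigits K a).support.card : ℝ) ≤ a := by exact_mod_cast card_support_lowDigits a
    have hh : ((highDigits K a b).support.card : ℝ) ≤ b := by
      exact_mod_cast card_support_highDigits a b
    have hM' : (M.support.card : ℝ) ≤ 1 := by exact_mod_cast card_support_X_pow_le _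
    have hT' : (T.support.card : ℝ) ≤ r := by
      have : T.support.card ≤ r := (card_support_sum_X_pow_le (range r) id).trans (by simp)
      exact_mod_cast this
    have hEc : (Er.support.card : ℝ) ≤ e := by exact_mod_cast hEc'
    have h1 : ((1 : K[X]).support.card : ℝ) ≤ 1 := by
      have := card_support_X_pow_le (K := K) 0
      rw [pow_zero] at this; exact_mod_cast this
    -- `|supp (A ± B)| ≤ |supp A| + |supp B|` for the eight composite bases
    have hadd := fun (A B : K[X]) => (Nat.cast_le (α := ℝ)).2 (card_support_add_le A B)
    have hsub := fun (A B : K[X]) => (Nat.cast_le (α := ℝ)).2 (card_support_sub_le A B)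
    have e1 := hadd 1 Dq
    have e2 := hsub 1 Dq
    have e3 := hadd (lowDigits K a) (highDigits K a b)
    have e4 := hsub (lowDigits K a) (highDigits K a b)
    have e5 := hadd M T
    have e6 := hsub M T
    have e7 := hadd 1 Er
    have e8 := hsub 1 Er
    push_cast at e1 e2 e3 e4 e5 e6 e7 e8
    simp only [Fin.sum_univ_succ, Fin.sum_univ_zero, Matrix.cons_val_zero, Matrix.cons_val_succ, add_zero]
    linarith

/-! ## The barrier -/

/-- **Restricted pair sums are far from the quadratic residues (from the crux).**  `CharPSparseSOS` (with
its exponent `δ`) implies: for all large primes `p` and every `Q ⊆ [0, p)`,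
`p^{1/2+δ} ≤ 3|Q| + 2·#{n < p : r_Q(n) ≠ 1_QR(n)} + 13√p + 13`, where
`r_Q(n) = #{(a,b) ∈ Q × Q : a < b, a + b ≡ n (mod p)}` and `1_QR(n) = [n ≠ 0 ∧ (n|p) = 1]`.  Indeed the
nine-square witness `rqf_witness` is a cyclic representation of `F̄_p` of degree `< p` with `9 ≤ p^δ`
squares and support-sum `≤ 3|Q| + 2e + 6√p + 10`.  (The case `e = 0` is the QR-perfect sum-set barrier
`no_qrPerfectSumSet_of_charPSparseSOS`; in general this is a power-saving form of Shkredov's theorem that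
the quadratic residues are not a restricted sumset.) -/
theorem rQ_far_from_QR_of_charPSparseSOS :
    Summit.ValiantsHypothesis.ValiantsHypothesis.Theses.FeketeSOS.CharPSparseSOS →
      ∃ δ : ℝ, 0 < δ ∧ ∃ p₁ : ℕ, ∀ (p : ℕ) [Fact p.Prime], p₁ ≤ p → ∀ Q : Finset ℕ, (∀ a ∈ Q, a < p) →
        (p : ℝ) ^ (1 / 2 + δ) ≤ 3 * (Q.card : ℝ) +
          2 * (((Finset.range p).filter (fun n => ((Q ×ˢ Q).filter
              (fun ab : ℕ × ℕ => ab.1 < ab.2 ∧ (ab.1 + ab.2) % p = n)).card ≠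
                (if n ≠ 0 ∧ legendreSym p n = 1 then 1 else 0))).card : ℝ) +
          13 * Real.sqrt p + 13 := by
  rintro ⟨δ, hδ, p₀, hmain⟩
  refine ⟨δ, hδ, max (max p₀ (⌈(9 : ℝ) ^ (1 / δ)⌉₊ + 2)) 5, ?_⟩
  intro p _ hp Q hQ
  have hpprime : p.Prime := Fact.out
  have hp5 : 5 ≤ p := le_of_max_le_right hp
  have hp₀ : p₀ ≤ p := le_of_max_le_left (le_of_max_le_left hp)
  have hceil' : ⌈(9 : ℝ) ^ (1 / δ)⌉₊ + 2 ≤ p := le_of_max_le_right (le_of_max_le_left hp)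
  have h4 : (4 : ZMod p) ≠ 0 := four_ne_zero_zmod p hp5
  obtain ⟨N, rfl⟩ : ∃ N, p = N + 1 := ⟨p - 1, (Nat.succ_pred_eq_of_pos hpprime.pos).symm⟩
  -- digits of N = p - 1 (as in `no_qrPerfectSumSet_of_charPSparseSOS`): N = a * b + r, 1 ≤ r ≤ a
  set a := Nat.sqrt N with ha
  set b := (N - 1) / a with hb
  set r := N - a * b with hr
  have hN4 : 4 ≤ N := by omega
  have ha1 : 1 ≤ a := by rw [ha]; exact Nat.le_sqrt.mpr (by nlinarith)
  have hdm : N - 1 = a * b + (N - 1) % a := by rw [hb]; exact (Nat.div_add_mod (N - 1) a).symm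
  have hmod : (N - 1) % a < a := Nat.mod_lt _ ha1
  have hNabr : N = a * b + r := by omega
  have hr1 : 1 ≤ r := by omega
  have hra : r ≤ a := by omega
  have haa : a * a ≤ N := by rw [ha]; exact Nat.sqrt_le N
  have hNlt : N < (a + 1) * (a + 1) := by rw [ha]; exact Nat.lt_succ_sqrt N
  have hb_le : b ≤ a + 2 := by
    rw [hb]
    have : N - 1 ≤ a * (a + 2) := by
      have : N ≤ a * (a + 2) := by nlinarith
      omega
    calc (N - 1) / a ≤ (a * (a + 2)) / a := Nat.div_le_div_right this
      _ = a + 2 := Nat.mul_div_cancel_left _ ha1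
  have haN : a ≤ N := (Nat.le_mul_self a).trans haa
  -- the crux applied to the nine-square witness
  obtain ⟨c, g, hdeg, hdvd, hsupp⟩ := rqf_witness N h4 Q hQ
    (fun n => ((Q ×ˢ Q).filter (fun ab : ℕ × ℕ => ab.1 < ab.2 ∧ (ab.1 + ab.2) % (N + 1) = n)).card)
    (fun n => if n ≠ 0 ∧ legendreSym (N + 1) n = 1 then 1 else 0)
    (rqf_fold_identity (N + 1) (Nat.succ_pos N) Q) (fun n => rfl)
    (((range (N + 1)).filter (fun n => ((Q ×ˢ Q).filter
        (fun ab : ℕ × ℕ => ab.1 < ab.2 ∧ (ab.1 + ab.2) % (N + 1) = n)).card ≠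
          (if n ≠ 0 ∧ legendreSym (N + 1) n = 1 then 1 else 0))).card) le_rfl
    a b r hNabr hr1 haN
  have key := hmain (N + 1) hp₀ (ZMod (N + 1)) 9 c g
  -- reals
  have hceil : (9 : ℝ) ^ (1 / δ) ≤ ((N + 1 : ℕ) : ℝ) := by
    have h1 : (⌈(9 : ℝ) ^ (1 / δ)⌉₊ : ℝ) ≤ ((N + 1 : ℕ) : ℝ) := by
      have : ⌈(9 : ℝ) ^ (1 / δ)⌉₊ ≤ N + 1 := by omega
      exact_mod_cast this
    exact le_trans (Nat.le_ceil _) h1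
  have hpδ : (9 : ℝ) ≤ ((N + 1 : ℕ) : ℝ) ^ δ := by
    have : ((9 : ℝ) ^ (1 / δ)) ^ δ ≤ ((N + 1 : ℕ) : ℝ) ^ δ :=
      Real.rpow_le_rpow (by positivity) hceil hδ.le
    rwa [← Real.rpow_mul (by norm_num), one_div_mul_cancel hδ.ne', Real.rpow_one] at this
  have hs : ((9 : ℕ) : ℝ) ≤ ((N + 1 : ℕ) : ℝ) ^ δ := by exact_mod_cast hpδ
  have hbound := key hs hdeg hdvd
  -- bookkeeping: 2(a + b + r) + 6 ≤ 6a + 10 ≤ 6√p + 10 ≤ 13√p + 13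
  have hb' : (b : ℝ) ≤ a + 2 := by exact_mod_cast hb_le
  have hr' : (r : ℝ) ≤ a := by exact_mod_cast hra
  have hsqrt : (a : ℝ) ≤ Real.sqrt ((N + 1 : ℕ) : ℝ) := by
    rw [← Real.sqrt_sq (Nat.cast_nonneg a)]
    apply Real.sqrt_le_sqrt
    have : ((a * a : ℕ) : ℝ) ≤ ((N + 1 : ℕ) : ℝ) := by exact_mod_cast haa.trans (Nat.le_succ N)
    push_cast at this ⊢; nlinarith
  have hsq0 : (0 : ℝ) ≤ Real.sqrt ((N + 1 : ℕ) : ℝ) := Real.sqrt_nonneg _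
  linarith

end

end Summit.ValiantsHypothesis.ValiantsHypothesis.Theorems.CharPSparseSOSTwoCusp
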